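import Summits.QuantumFields.BalabanUV.Beta.D1BFx.PackedStraightColumnMass
import Summits.QuantumFields.BalabanUV.Beta.D1BFx.PackedColumnBlockTotalOfPerSlot
import Summits.QuantumFields.BalabanUV.Beta.D1BFx.RawStencilSupportRows

/-!
# `BalabanUV.Beta.D1BFx.PackedStraightColumnWilsonVertex` — road «BF-x» for binder row D1, slot (K), PART 24 letter «M-pack» AT THE CHART OF RECORD (α′), FILE D of «K0-PACK»:
# **R-T's FIRST-JET PER-SCALE LETTERS `hVs ∕ hVm` AT THE STRAIGHT PIN (power `p` from per-slot letters `≤ n^{p+1}·m̄`), AND THE PURE-WILSON CUBIC SECTOR AT POWER 3,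
# HYPOTHESIS-FREE** — the unit page's «`V_tt`: `Σ|h|·|w₃| ≍ n³·m̄V`» as a theorem for the Wilson sector; the other sectors of `S⁰` stay displayed per-slot letters

HONEST DEPENDENCY (cell records, verbatim): «continuum YM on T⁴ ⇐ BetaPertH ∧ nine spine estimates (0/9 proved); BetaPertH ⇐ (D1) ∧ (D4) ∧
CAP+tail; G-an2-4 gates asym, D1 and NE2/3/4.»  HONEST FRAMING (cell contract, verbatim): «discharging `BetaPertH` makes Bałaban's UV stability
UNCONDITIONAL — a real constructive-QFT result; it is NOT the continuum limit and NOT the Clay problem.»  THIS MODULE DISCHARGES NOTHING of the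
wall: [folklore] `ℓ¹` bookkeeping BY NAME over LANDED objects («K0-PACK» FILE B `PackedStraightColumnMass` §3, this lineage's FILE 5
`PackedColumnBlockTotalOfPerSlot.blockTotal_le_of_forall_le`, d1-leaf-01's `RawStencilSupportRows.mass_blk_wilsonA_le` over `StepJetData.wilsonA ∕ wBound ∕ locStencil_wilsonA`).
No definition, no `def … : Prop`, nothing cited, 0 sorry.  Nothing of the Wilson table or of Bałaban's is asserted (`wBound 3` symbolic); NO (1.22) row is proved (R-T's rows
are the OWNER's, modulo `h12 ∧ h126`); 0 root-level binders of row D1 discharged (hW ∕ hR-sockets ∕ hSX-socket ∕ D1Tel ∕ D1Rep = 0); (J1) ONE OPEN ROW; (K) NOT closed; NOT D1,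
NEVER «G-an2-4 closed», NOT `BetaPertH`, NOT continuum, NOT Clay.

ABSOLUTE RULE (cell charter, verbatim): «No internally-minted statement may enter as a cited fact. Every hypothesis is either kernel-proved in
this package or a verbatim quotation of a PUBLISHED theorem with page reference. The manuscript(s) under audit are NOT citable for their own
disputed steps — they are the thing under adjudication; programme-internal (2001/route/tribunal) claims are never citable.»

WHY.  `PART24-HEAD-SPEC-g23.md` (H4)(c): the head keeps R-T's sandwich rows `RestKernelSandwichScaled.exists_rows_RkSand_scaled` over PER-SCALE letters; besides the pair
letters `hWs ∕ hWm` (FILE C, power 2 for the Wilson sector) they take the FIRST-JET letters `hVs ∕ hVm : ∀ m ρ y, Σ'_p Σ_{g f} |ffV (𝒱 (m+1)) ρ y p g f|·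
e^{(σV∕(m+1))·(|p.1 − n•y|₁ + |p.2 − n•y|₁)} ≤ mV m` — EXACTLY FILE B §3's `u`-centred weighted block mass of `vertexOfK (KInvStep 3 n 0) n S ρ y` at `σ := σV∕n`, read on the
tt block (`PackedKernelSplit.ffV_apply`).  §1 turns uniform per-slot letters `≤ n^{p+1}·m̄` into that shape with POWER `p` (block totals `= n⁴ ×` per slot by FILE 5's count,
then the straight column's `n⁻⁵`); §2 instantiates at the literal's Wilson cubic sector `cE • wilsonA` (`cE = n⁴`) with d1-leaf-01's n-free per-slot letter
(`mass_blk_wilsonA_le`: `≤ 16·(wBound 3·e⁴)·Zl 4 (1∕2)²` for `σ ≤ 1∕2`) ⟹ `p = 3`, HYPOTHESIS-FREE: UNIT-PAGE-g23 §1's «`V_tt` mass `≍ n³·m̄V`» as a kernel theorem.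
With FILE C, BOTH per-scale letter families of R-T are hypothesis-free for the pure-Wilson straight-pin families, so `exists_rows_RkSand_scaled` DISPLAYS the bubble
members' residual powers `(K∕2∕n²)²·(n³·C)² = n²·(…)` by kernel arithmetic — PART24-SPEC §1's «the bubbles need ONE derivative gain per vertex», exact and NOT closed here.

CONTENT (`n = m + 1`; `C₁ := 4·(C₄·e^{κ′})·e^{κ′∕2}·Zl 4 (κ′∕8)`, `C₄ := MG163 4·periodConst (kappa163 4) 3`, `κ′ := kappa163 4 ∕ 4`).
* §1 **`ffV_vertexOfK_K₀_rows_pow`** (any per-scale first-jet pack `S n`; `0 < σV ≤ kappa163 4 ∕ 64`; per-slot letters at rate `σV∕(m+1)` for all four blocks,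
  `≤ ((m+1):ℝ)^{p+1}·m̄` ⟹ `hVs` ∧ `hVm` with `mV m := ((m+1):ℝ)^p·(C₁·m̄)`).
* §2 (`blk (c • K) = c • blk K` entrywise `rfl` — FILE C's `blk_smul_apply`, not re-declared) **`mass_blk_smul_wilsonA_le`** (per slot: `c • wilsonA 3 κ u`'s blocks have weighted mass `≤ |c|·(16·(wBound 3·e⁴)·Zl 4 (1∕2)²)`, `σ ≤ 1∕2`),
  **`ffV_vertexOfK_K₀_wilsonA_rows`** (`𝒱 n := vertexOfK (KInvStep 3 n 0) n ((((n:ℕ):ℝ)^4·c₀) • wilsonA 3)`: `hVs` ∧ `hVm` with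
  `mV m := ((m+1):ℝ)^3·(C₁·(|c₀|·16·(wBound 3·e⁴)·Zl 4 (1∕2)²))`, `0 < σV ≤ kappa163 4 ∕ 64`, `σV ≤ 1∕2`) and **`_unit`** (`c₀ = 1`).
NOT HERE (honest): the `tabs.V` ∕ `SLam` sectors of the literal's `S⁰` (their per-slot letters are d1-leaf-01's §3 `hSs_raw_scales(_an1)` ∕ an1's — displayed letters feed §1
the same way, power as the table author counts it); any (1.22) row; any closing of a bubble member; the cross-word cancellation (R10).
Unit `b2b-balaban-gan24-formalise-leaf-05` (gen 60), G-an2-4 swarm leaf prover 05, road «BF-x» supplier; INTENT-3 «K0-WILSON-VERTEX» (journal [GAN24LEAF05-G60-INTENT-3]).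
-/

noncomputable section

open Finset
open scoped BigOperators
open Literature.MathematicalPhysics.QuantumFieldTheory
open Literature.MathematicalPhysics.QuantumFieldTheory.Balaban1983to89
open Literature.MathematicalPhysics.QuantumFieldTheory.Balaban1983to89.Beta
open B12Sec2to5 (l1 l1_nonneg)
open B5Hk163Strip (kappa163 kappa163_pos)
open B5Hk163Decay (MG163)
open B4TorusKernel (periodConst)
open ExpKernelCalculus (Site MKer Zl Zl_pos Zl_nonneg)
open AffineAveraging (box toSite)
open OneStepResolventKernel (Fib wsum)
open OneStepKernelFamily (colH KInvStep vertexOfK)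
open StepJetData (wilsonA wBound wBound_nonneg)
open Summit.QuantumFields.BalabanUV.Beta.D1BFx.PackedKernelSplit (blk ffV)
open Summit.QuantumFields.BalabanUV.Beta.D1BFx.PackedColumnBlockTotalOfPerSlot (blockTotal_le_of_forall_le)
open Summit.QuantumFields.BalabanUV.Beta.D1BFx.RawStencilSupportRows (mass_blk_wilsonA_le)
open Summit.QuantumFields.BalabanUV.Beta.D1BFx.PackedStraightColumnMass (mass_blk_vertexOfK_K₀_le_pow)

namespace Summit.QuantumFields.BalabanUV.Beta.D1BFx.PackedStraightColumnWilsonVertex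

/-! ## §1 R-T's first-jet per-scale letters at the straight pin from uniform per-slot letters -/

section RT

/-- [folklore] **THE `hVs ∕ hVm` SHAPE OF R-T `RestKernelSandwichScaled.exists_rows_RkSand_scaled` FOR A STRAIGHT-PIN FIRST-JET FAMILY, POWER DISPLAYED**: for a per-scale
first-jet pack `S n` whose blocks have, at every scale `n = m + 1`, summable `u`-centred `(σV∕n)`-weighted masses with the UNIFORM per-slot letter `≤ n^{p+1}·m̄` (all four blocks;
the table author's count with every unit of the literal included), and `0 < σV ≤ kappa163 4 ∕ 64` (so `σV∕n ≤ κ′∕(16n)`), the family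
`𝒱 n := vertexOfK (KInvStep 3 n 0) n (S n)` satisfies, for every `ρ m y`: `Summable (q ↦ Σ_{g f} |ffV (𝒱 (m+1)) ρ y q g f|·e^{(σV∕(m+1))(|q.1 − n•y|₁ + |q.2 − n•y|₁)})` and
`Σ' … ≤ ((m+1):ℝ)^p·(C₁·m̄)` — per slot `≤ n^{p+1}·m̄` ⟹ block totals `≤ n⁴·(n^{p+1}·m̄) = n^{p+5}·m̄` (FILE 5 `blockTotal_le_of_forall_le`) ⟹ FILE B `mass_blk_vertexOfK_K₀_le_pow`
(the straight column pays `n⁻⁵`); `ffV V ρ y = blk (V ρ y) tt tt` (`PackedKernelSplit.ffV_apply`, rfl). -/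
theorem ffV_vertexOfK_K₀_rows_pow (p : ℕ) {S : ℕ → Fin (3 + 1) → (Fin (3 + 1) → ℤ) → MKer 4 (Fib 3)} {σV mS : ℝ}
    (hσV0 : 0 < σV) (hσV : σV ≤ kappa163 4 / 64)
    (hSs : ∀ (m : ℕ) (κ : Fin (3 + 1)) (u : Fin (3 + 1) → ℤ) (j k : Bool), Summable fun q : Site 4 × Site 4 =>
      ∑ g, ∑ f, |blk (S (m + 1) κ u) j k q.1 q.2 g f| * Real.exp (σV / ((m + 1 : ℕ) : ℝ) * (l1 (q.1 - u) + l1 (q.2 - u))))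
    (hSm : ∀ (m : ℕ) (κ : Fin (3 + 1)) (u : Fin (3 + 1) → ℤ) (j k : Bool), ∑' q : Site 4 × Site 4,
      ∑ g, ∑ f, |blk (S (m + 1) κ u) j k q.1 q.2 g f| * Real.exp (σV / ((m + 1 : ℕ) : ℝ) * (l1 (q.1 - u) + l1 (q.2 - u)))
        ≤ ((m + 1 : ℕ) : ℝ) ^ (p + 1) * mS)
    (ρ : Fin (3 + 1)) (m : ℕ) (y : Fin (3 + 1) → ℤ) :
    (Summable fun q : Site 4 × Site 4 => ∑ g, ∑ f,
        |ffV (vertexOfK (KInvStep (d := 3) (m + 1) 0) (m + 1) (S (m + 1))) ρ y q.1 q.2 g f|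
          * Real.exp (σV / ((m + 1 : ℕ) : ℝ) * (l1 (q.1 - ((m + 1 : ℕ) : ℤ) • y) + l1 (q.2 - ((m + 1 : ℕ) : ℤ) • y)))) ∧
      ∑' q : Site 4 × Site 4, ∑ g, ∑ f,
          |ffV (vertexOfK (KInvStep (d := 3) (m + 1) 0) (m + 1) (S (m + 1))) ρ y q.1 q.2 g f|
            * Real.exp (σV / ((m + 1 : ℕ) : ℝ) * (l1 (q.1 - ((m + 1 : ℕ) : ℤ) • y) + l1 (q.2 - ((m + 1 : ℕ) : ℤ) • y)))
        ≤ ((m + 1 : ℕ) : ℝ) ^ p * ((4 * ((MG163 4 * periodConst (kappa163 4) 3) * Real.exp (kappa163 4 / 4))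
            * Real.exp (kappa163 4 / 4 / 2) * Zl 4 (kappa163 4 / 4 / 8)) * mS) := by
  have hn0 : (0 : ℝ) < ((m + 1 : ℕ) : ℝ) := by exact_mod_cast Nat.succ_pos m
  have hσ0 : 0 ≤ σV / ((m + 1 : ℕ) : ℝ) := by positivity
  have hσ : σV / ((m + 1 : ℕ) : ℝ) ≤ kappa163 4 / 4 / (16 * ((m + 1 : ℕ) : ℝ)) := by
    have h1 : σV / ((m + 1 : ℕ) : ℝ) ≤ (kappa163 4 / 64) / ((m + 1 : ℕ) : ℝ) := div_le_div_of_nonneg_right hσV hn0.le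
    refine h1.trans (le_of_eq ?_)
    field_simp
    ring
  -- block totals from the uniform per-slot letter: `n⁴ · (n^{p+1}·m̄) = n^{p+5}·m̄`
  have hSB : ∀ (κ : Fin (3 + 1)) (y' : Fin (3 + 1) → ℤ) (j k : Bool), ∑ b ∈ box (3 + 1) (m + 1),
      (∑' q : Site 4 × Site 4, ∑ g, ∑ f, |blk (S (m + 1) κ (((m + 1 : ℕ) : ℤ) • y' + toSite b)) j k q.1 q.2 g f|
        * Real.exp (σV / ((m + 1 : ℕ) : ℝ) * (l1 (q.1 - (((m + 1 : ℕ) : ℤ) • y' + toSite b)) + l1 (q.2 - (((m + 1 : ℕ) : ℤ) • y' + toSite b)))))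
      ≤ ((m + 1 : ℕ) : ℝ) ^ (p + 5) * mS := by
    intro κ y' j k
    have h := blockTotal_le_of_forall_le (D := 3 + 1) (n := m + 1)
      (m := fun u => ∑' q : Site 4 × Site 4, ∑ g, ∑ f, |blk (S (m + 1) κ u) j k q.1 q.2 g f|
        * Real.exp (σV / ((m + 1 : ℕ) : ℝ) * (l1 (q.1 - u) + l1 (q.2 - u)))) (fun u => hSm m κ u j k) y'
    refine h.trans (le_of_eq ?_)
    rw [pow_add, pow_add]
    ring
  have h := mass_blk_vertexOfK_K₀_le_pow (m + 1) p (S := S (m + 1)) (mS := fun _ _ => mS) hσ0 hσ (fun κ u j k => hSs m κ u j k) hSB ρ y true true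
  rw [PackedKernelSplit.ffV_apply]
  exact ⟨h.1, h.2.trans (le_of_eq (by ring))⟩

end RT

/-! ## §2 The literal's Wilson cubic sector `cE • wilsonA` (`cE = n⁴`): power 3, hypothesis-free -/

section Wilson

/-- [folklore] **THE PER-SLOT LETTER OF A SCALED WILSON CUBIC TABLE**: for every `c : ℝ` and `σ ≤ 1∕2`, every block of `c • wilsonA 3 κ u` has summable `u`-centred `σ`-weighted mass
`≤ |c|·(16·(wBound 3·e⁴)·Zl 4 (1∕2)²)` — d1-leaf-01 `RawStencilSupportRows.mass_blk_wilsonA_le` BY NAME + `tsum_mul_left`. -/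
theorem mass_blk_smul_wilsonA_le (c : ℝ) {σ : ℝ} (hσ : σ ≤ 1 / 2) (κ : Fin (3 + 1)) (u : Fin (3 + 1) → ℤ) (j k : Bool) :
    (Summable fun q : Site 4 × Site 4 => ∑ g, ∑ f, |blk (c • wilsonA 3 κ u) j k q.1 q.2 g f| * Real.exp (σ * (l1 (q.1 - u) + l1 (q.2 - u)))) ∧
      ∑' q : Site 4 × Site 4, ∑ g, ∑ f, |blk (c • wilsonA 3 κ u) j k q.1 q.2 g f| * Real.exp (σ * (l1 (q.1 - u) + l1 (q.2 - u)))
        ≤ |c| * (16 * (wBound 3 * Real.exp (4 * 1)) * Zl 4 (1 / 2) ^ 2) := by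
  obtain ⟨hs, hb⟩ := mass_blk_wilsonA_le hσ κ u j k
  have e : (fun q : Site 4 × Site 4 => ∑ g, ∑ f, |blk (c • wilsonA 3 κ u) j k q.1 q.2 g f| * Real.exp (σ * (l1 (q.1 - u) + l1 (q.2 - u))))
      = fun q => |c| * (∑ g, ∑ f, |blk (wilsonA 3 κ u) j k q.1 q.2 g f| * Real.exp (σ * (l1 (q.1 - u) + l1 (q.2 - u)))) := by
    funext q
    rw [Finset.mul_sum]
    refine Finset.sum_congr rfl fun g _ => ?_
    rw [Finset.mul_sum]
    refine Finset.sum_congr rfl fun f _ => ?_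
    rw [show blk (c • wilsonA 3 κ u) j k q.1 q.2 g f = c * blk (wilsonA 3 κ u) j k q.1 q.2 g f from rfl, abs_mul, mul_assoc]
  rw [e]
  refine ⟨hs.mul_left _, ?_⟩
  rw [tsum_mul_left]
  exact mul_le_mul_of_nonneg_left hb (abs_nonneg c)

/-- [folklore] **R-T's FIRST-JET LETTERS FOR THE PURE-WILSON CUBIC STRAIGHT-PIN FAMILY, POWER 3, HYPOTHESIS-FREE**: for
`𝒱 n := vertexOfK (KInvStep 3 n 0) n (fun κ u => ((((n:ℕ):ℝ))^4·c₀) • wilsonA 3 κ u)` (the literal's `cE = n⁴` displayed), `0 < σV ≤ kappa163 4 ∕ 64`, `σV ≤ 1∕2`, every `ρ m y`: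
`hVs` ∧ `hVm` with `mV m := ((m+1):ℝ)^3·(C₁·(|c₀|·16·(wBound 3·e⁴)·Zl 4 (1∕2)²))` — §1 at `p = 3` (per slot `n⁴·|c₀|·(…) = n^{3+1}·(…)`).  UNIT-PAGE-g23 §1 «`V_tt ≍ n³·m̄V`». -/
theorem ffV_vertexOfK_K₀_wilsonA_rows (c₀ : ℝ) {σV : ℝ} (hσV0 : 0 < σV) (hσV : σV ≤ kappa163 4 / 64) (hσV2 : σV ≤ 1 / 2)
    (ρ : Fin (3 + 1)) (m : ℕ) (y : Fin (3 + 1) → ℤ) :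
    (Summable fun q : Site 4 × Site 4 => ∑ g, ∑ f,
        |ffV (vertexOfK (KInvStep (d := 3) (m + 1) 0) (m + 1)
          (fun κ u => ((((m + 1 : ℕ) : ℝ)) ^ 4 * c₀) • wilsonA 3 κ u)) ρ y q.1 q.2 g f|
          * Real.exp (σV / ((m + 1 : ℕ) : ℝ) * (l1 (q.1 - ((m + 1 : ℕ) : ℤ) • y) + l1 (q.2 - ((m + 1 : ℕ) : ℤ) • y)))) ∧
      ∑' q : Site 4 × Site 4, ∑ g, ∑ f,
          |ffV (vertexOfK (KInvStep (d := 3) (m + 1) 0) (m + 1)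
            (fun κ u => ((((m + 1 : ℕ) : ℝ)) ^ 4 * c₀) • wilsonA 3 κ u)) ρ y q.1 q.2 g f|
            * Real.exp (σV / ((m + 1 : ℕ) : ℝ) * (l1 (q.1 - ((m + 1 : ℕ) : ℤ) • y) + l1 (q.2 - ((m + 1 : ℕ) : ℤ) • y)))
        ≤ ((m + 1 : ℕ) : ℝ) ^ 3 * ((4 * ((MG163 4 * periodConst (kappa163 4) 3) * Real.exp (kappa163 4 / 4))
            * Real.exp (kappa163 4 / 4 / 2) * Zl 4 (kappa163 4 / 4 / 8))
            * (|c₀| * (16 * (wBound 3 * Real.exp (4 * 1)) * Zl 4 (1 / 2) ^ 2))) := by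
  refine ffV_vertexOfK_K₀_rows_pow 3 (S := fun n κ u => ((((n : ℕ) : ℝ)) ^ 4 * c₀) • wilsonA 3 κ u)
    (mS := |c₀| * (16 * (wBound 3 * Real.exp (4 * 1)) * Zl 4 (1 / 2) ^ 2)) hσV0 hσV (fun m κ u j k => ?_) (fun m κ u j k => ?_) ρ m y
  · -- summability at `σ = σV∕(m+1) ≤ 1∕2`
    have hn1 : (1 : ℝ) ≤ ((m + 1 : ℕ) : ℝ) := by exact_mod_cast Nat.le_add_left 1 m
    have hσ : σV / ((m + 1 : ℕ) : ℝ) ≤ 1 / 2 := (div_le_self hσV0.le hn1).trans hσV2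
    exact (mass_blk_smul_wilsonA_le _ hσ κ u j k).1
  · have hn0 : (0 : ℝ) ≤ ((m + 1 : ℕ) : ℝ) := by positivity
    have hn1 : (1 : ℝ) ≤ ((m + 1 : ℕ) : ℝ) := by exact_mod_cast Nat.le_add_left 1 m
    have hσ : σV / ((m + 1 : ℕ) : ℝ) ≤ 1 / 2 := (div_le_self hσV0.le hn1).trans hσV2
    refine (mass_blk_smul_wilsonA_le _ hσ κ u j k).2.trans (le_of_eq ?_)
    rw [abs_mul, abs_of_nonneg (pow_nonneg hn0 4), pow_add]
    ring

/-- [folklore] The same with the bare unit `n⁴` (`c₀ = 1`): the spelling `cE • wilsonA` with `cE = n⁴` of the literal's first-jet pack. -/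
theorem ffV_vertexOfK_K₀_wilsonA_rows_unit {σV : ℝ} (hσV0 : 0 < σV) (hσV : σV ≤ kappa163 4 / 64) (hσV2 : σV ≤ 1 / 2)
    (ρ : Fin (3 + 1)) (m : ℕ) (y : Fin (3 + 1) → ℤ) :
    (Summable fun q : Site 4 × Site 4 => ∑ g, ∑ f,
        |ffV (vertexOfK (KInvStep (d := 3) (m + 1) 0) (m + 1)
          (fun κ u => ((((m + 1 : ℕ) : ℝ)) ^ 4) • wilsonA 3 κ u)) ρ y q.1 q.2 g f|
          * Real.exp (σV / ((m + 1 : ℕ) : ℝ) * (l1 (q.1 - ((m + 1 : ℕ) : ℤ) • y) + l1 (q.2 - ((m + 1 : ℕ) : ℤ) • y)))) ∧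
      ∑' q : Site 4 × Site 4, ∑ g, ∑ f,
          |ffV (vertexOfK (KInvStep (d := 3) (m + 1) 0) (m + 1)
            (fun κ u => ((((m + 1 : ℕ) : ℝ)) ^ 4) • wilsonA 3 κ u)) ρ y q.1 q.2 g f|
            * Real.exp (σV / ((m + 1 : ℕ) : ℝ) * (l1 (q.1 - ((m + 1 : ℕ) : ℤ) • y) + l1 (q.2 - ((m + 1 : ℕ) : ℤ) • y)))
        ≤ ((m + 1 : ℕ) : ℝ) ^ 3 * ((4 * ((MG163 4 * periodConst (kappa163 4) 3) * Real.exp (kappa163 4 / 4))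
            * Real.exp (kappa163 4 / 4 / 2) * Zl 4 (kappa163 4 / 4 / 8))
            * (16 * (wBound 3 * Real.exp (4 * 1)) * Zl 4 (1 / 2) ^ 2)) := by
  have h := ffV_vertexOfK_K₀_wilsonA_rows 1 hσV0 hσV hσV2 ρ m y
  simpa only [mul_one, abs_one, one_mul] using h

end Wilson

end Summit.QuantumFields.BalabanUV.Beta.D1BFx.PackedStraightColumnWilsonVertex

end
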